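import Literature.Geometry.Lorentzian.KerrCarterFrequencyIdentity
import Literature.Analysis.FunctionSpaces.LpPathRegularSelection
import Mathlib.MeasureTheory.Measure.SeparableMeasure
import HarnessLib

/-!
# Plancherel identities for the star-chart separation (DRSR §5.3)

Dafermos–Rodnianski–Shlapentokh-Rothman, arXiv:1402.7034, §5.3 ("Applying Plancherel"): the
frequency-space quantities `∫_ω Σ_{mℓ} (|u|², |u'|², Λ|u|², ω²|u|², |H|²)` are identified with
physical-space integrals. In the tree's `L²` separation (time Fourier transform on
`L²(ℝ_t; 𝓗)`, `𝓗 = L²(S²)`, and the oblate spheroidal Hilbert basis `Ψ_q(ν)` of `𝓗`) these are: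

* **angular Parseval with the eigenvalue weight, basis-free** (`Kerr.hasSum_eig_mul_inner`,
  `Kerr.hasSum_eig_mul_norm_sq`): if `s` is the weak angular Laplacian of `u`
  (`⟪Y_{mk}, s⟫ = k(k+1)… ⟪Y_{mk}, u⟫` for the fixed spherical-harmonic basis), then
  `Σ_q λ_q(ν) |⟪Ψ_q(ν), u⟫|² = Re ⟪u, s⟫ - ν² Re ⟪u, cos²θ · u⟫`, and
  `Re ⟪u, s⟫ = Σ_{mk} level_{mk} |⟪Y_{mk}, u⟫|² ≥ 0` (`Kerr.hasSum_level_mul_norm_sq`) — the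
  right-hand sides are measurable functions of the frequency when `u, s` are, which is how the
  `ν = aω`-dependence of the basis is kept out of all frequency integrals;
* **Plancherel in time** (`Kerr.integral_norm_sq_freqLp`, `Kerr.integral_inner_freqLp`,
  `Kerr.lintegral_enorm_sq_freqLp`): `∫_ξ ‖Ĝ(r, ξ)‖²_𝓗 dξ = ∫_t ‖G(t, r, ·)‖²_𝓗 dt` and its
  polarisation, for the frequency classes `Kerr.freqLp`.

## References

* M. Dafermos, I. Rodnianski, Y. Shlapentokh-Rothman, arXiv:1402.7034, §5.3.
  [DafermosRodnianskiShlapentokhrothman2014]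
-/

noncomputable section

open Real Set Filter MeasureTheory Function
open scoped Topology ENNReal InnerProductSpace ComplexConjugate FourierTransform

namespace Literature.Geometry.Lorentzian

namespace Kerr

open Literature.Analysis.SpecialFunctions Literature.Analysis.FunctionSpaces
  Literature.Analysis.Fourier

variable [h2π : Fact (0 < 2 * π)]

/-! ### Angular Parseval with the eigenvalue weight -/

/-- **`Σ_q λ_q(ν) ⟪u, Ψ_q⟫⟪Ψ_q, u⟫ = ⟪u, s⟫ - ν² ⟪u, cos²θ·u⟫`** for `s` the weak angular
Laplacian of `u`. [cite: DafermosRodnianskiShlapentokhrothman2014, §5.3 with §5.2.1 (33)] -/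
theorem hasSum_eig_mul_inner (ν : ℝ) (u s : AngSpace)
    (hpair : ∀ (m : ℤ) (k : ℕ), ⟪sphHarmTensor (2 * π) m k, s⟫_ℂ =
      (assocLegLevel m.natAbs k : ℂ) * ⟪sphHarmTensor (2 * π) m k, u⟫_ℂ) :
    HasSum (fun q : OblateSphereIndex ν ↦ (oblateSphereEig ν q : ℂ) *
        (⟪u, oblateSphereBasis (2 * π) ν q⟫_ℂ * ⟪oblateSphereBasis (2 * π) ν q, u⟫_ℂ))
      (⟪u, s⟫_ℂ - ((ν ^ 2 : ℝ) : ℂ) * ⟪u, mulSqFst (2 * π) u⟫_ℂ) := by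
  have P1 := (oblateSphereBasis (2 * π) ν).hasSum_inner_mul_inner u s
  have P2 := (oblateSphereBasis (2 * π) ν).hasSum_inner_mul_inner u (mulSqFst (2 * π) u)
  refine (P1.sub (P2.mul_left (((ν ^ 2 : ℝ) : ℂ)))).congr_fun fun q ↦ ?_
  have hq := oblateSphere_weak_of_pair (T := 2 * π) ν q u s hpair
  linear_combination -(⟪u, oblateSphereBasis (2 * π) ν q⟫_ℂ * hq)

/-- **`Σ_q λ_q(ν) |⟪Ψ_q, u⟫|² = Re ⟪u, s⟫ - ν² Re ⟪u, cos²θ·u⟫`** (real form).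
[cite: DafermosRodnianskiShlapentokhrothman2014, §5.3] -/
theorem hasSum_eig_mul_norm_sq (ν : ℝ) (u s : AngSpace)
    (hpair : ∀ (m : ℤ) (k : ℕ), ⟪sphHarmTensor (2 * π) m k, s⟫_ℂ =
      (assocLegLevel m.natAbs k : ℂ) * ⟪sphHarmTensor (2 * π) m k, u⟫_ℂ) :
    HasSum (fun q : OblateSphereIndex ν ↦ oblateSphereEig ν q *
        ‖⟪oblateSphereBasis (2 * π) ν q, u⟫_ℂ‖ ^ 2)
      ((⟪u, s⟫_ℂ).re - ν ^ 2 * (⟪u, mulSqFst (2 * π) u⟫_ℂ).re) := by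
  have h0 : HasSum (fun q : OblateSphereIndex ν ↦
      ((oblateSphereEig ν q * ‖⟪oblateSphereBasis (2 * π) ν q, u⟫_ℂ‖ ^ 2 : ℝ) : ℂ))
      (⟪u, s⟫_ℂ - ((ν ^ 2 : ℝ) : ℂ) * ⟪u, mulSqFst (2 * π) u⟫_ℂ) := by
    refine (hasSum_eig_mul_inner ν u s hpair).congr_fun fun q ↦ ?_
    rw [← inner_conj_symm u, Complex.conj_mul']
    push_cast
    ring
  have h := h0.mapL Complex.reCLM
  simp only [Complex.reCLM_apply, Complex.ofReal_re, Complex.sub_re, Complex.re_ofReal_mul] at h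
  exact h

/-- **`Re ⟪u, s⟫ = Σ_{mk} level_{mk} |⟪Y_{mk}, u⟫|²`** (so it is `≥ 0`). [folklore] -/
theorem hasSum_level_mul_norm_sq (u s : AngSpace)
    (hpair : ∀ (m : ℤ) (k : ℕ), ⟪sphHarmTensor (2 * π) m k, s⟫_ℂ =
      (assocLegLevel m.natAbs k : ℂ) * ⟪sphHarmTensor (2 * π) m k, u⟫_ℂ) :
    HasSum (fun q : Σ _ : ℤ, ℕ ↦ assocLegLevel q.1.natAbs q.2 *
      ‖⟪sphHarmTensor (2 * π) q.1 q.2, u⟫_ℂ‖ ^ 2) (⟪u, s⟫_ℂ).re := by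
  obtain ⟨b, hb⟩ := exists_hilbertBasis_sphHarmTensor (T := 2 * π)
  have P0 : HasSum (fun q : Σ _ : ℤ, ℕ ↦ ((assocLegLevel q.1.natAbs q.2 *
      ‖⟪sphHarmTensor (2 * π) q.1 q.2, u⟫_ℂ‖ ^ 2 : ℝ) : ℂ)) ⟪u, s⟫_ℂ := by
    refine (b.hasSum_inner_mul_inner u s).congr_fun fun q ↦ ?_
    rw [hb q, hpair q.1 q.2, ← inner_conj_symm u, mul_left_comm, Complex.conj_mul']
    push_cast
    ring
  have P := P0.mapL Complex.reCLM
  simp only [Complex.reCLM_apply, Complex.ofReal_re] at P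
  exact P

/-- Non-negativity of `Re ⟪u, s⟫`. [folklore] -/
theorem inner_weakLaplacian_re_nonneg (u s : AngSpace)
    (hpair : ∀ (m : ℤ) (k : ℕ), ⟪sphHarmTensor (2 * π) m k, s⟫_ℂ =
      (assocLegLevel m.natAbs k : ℂ) * ⟪sphHarmTensor (2 * π) m k, u⟫_ℂ) :
    0 ≤ (⟪u, s⟫_ℂ).re :=
  (hasSum_level_mul_norm_sq u s hpair).nonneg fun q ↦
    mul_nonneg (by unfold assocLegLevel; positivity) (sq_nonneg _)

/-! ### The eigenvalue-weighted Parseval for the frequency classes of `Φ ∘ κ_a` -/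

/-- **Frequency-space form identity, for a.e. `ξ` and every `ν` simultaneously**: with
`û = 𝓕_t(Φ ∘ κ_a)(r, ξ)` and `Ŝ = 𝓕_t(Δ̸_{S²}(Φ) ∘ κ_a)(r, ξ)`,
`Σ_q λ_q(ν) |⟪Ψ_q(ν), û⟫|² = -Re ⟪û, Ŝ⟫ - ν² Re ⟪û, cos²θ · û⟫`
(in particular for `ν = aω(ξ)`; the null set does not depend on `ν`).
[cite: DafermosRodnianskiShlapentokhrothman2014, §5.3] -/
theorem ae_hasSum_eig_mul_norm_sq (a : ℝ) {Φ : E4 → ℝ} (hΦ : ContDiff ℝ 2 Φ)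
    (hIF : ∀ r, TimeSqInt (starPull a Φ) (contDiff_two_starPull a hΦ).continuous r)
    (hIS : ∀ r, TimeSqInt (sphLaplacianStar a Φ) (continuous_sphLaplacianStar a hΦ) r) {r : ℝ}
    (hr : 0 < r) :
    ∀ᵐ ξ ∂volume, ∀ ν : ℝ, HasSum (fun q : OblateSphereIndex ν ↦ oblateSphereEig ν q *
        ‖⟪oblateSphereBasis (2 * π) ν q, (freqLp (starPull a Φ)
          (contDiff_two_starPull a hΦ).continuous hIF r : ℝ → AngSpace) ξ⟫_ℂ‖ ^ 2)
      (-(⟪(freqLp (starPull a Φ) (contDiff_two_starPull a hΦ).continuous hIF r : ℝ → AngSpace) ξ,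
          (freqLp (sphLaplacianStar a Φ) (continuous_sphLaplacianStar a hΦ) hIS r :
            ℝ → AngSpace) ξ⟫_ℂ).re -
        ν ^ 2 * (⟪(freqLp (starPull a Φ) (contDiff_two_starPull a hΦ).continuous hIF r :
            ℝ → AngSpace) ξ,
          mulSqFst (2 * π) ((freqLp (starPull a Φ) (contDiff_two_starPull a hΦ).continuous hIF r :
            ℝ → AngSpace) ξ)⟫_ℂ).re) := by
  filter_upwards [ae_laplacianPair (a := a) hΦ hIF hIS hr] with ξ hξ
  intro ν
  have hpair : ∀ (m : ℤ) (k : ℕ), ⟪sphHarmTensor (2 * π) m k,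
      -(freqLp (sphLaplacianStar a Φ) (continuous_sphLaplacianStar a hΦ) hIS r :
        ℝ → AngSpace) ξ⟫_ℂ = (assocLegLevel m.natAbs k : ℂ) * ⟪sphHarmTensor (2 * π) m k,
      (freqLp (starPull a Φ) (contDiff_two_starPull a hΦ).continuous hIF r : ℝ → AngSpace) ξ⟫_ℂ :=
    fun m k ↦ by rw [inner_neg_right, hξ (m, k)]; ring
  have h := hasSum_eig_mul_norm_sq ν _ _ hpair
  rwa [inner_neg_right, Complex.neg_re] at h

/-- **The time derivative in frequency space, norm form**: for a.e. `ξ`,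
`‖𝓕_t(∂_{t*}G)(r, ξ)‖ = 2π|ξ| ‖Ĝ(r, ξ)‖` (i.e. `|ω| ‖Ĝ‖`).
[cite: DafermosRodnianskiShlapentokhrothman2014, §5.3] -/
theorem ae_norm_freqLp_dir0 {G : E4 → ℝ} (hG : ContDiff ℝ 1 G)
    (hI₀ : ∀ r, TimeSqInt G hG.continuous r)
    (hIt : ∀ r, TimeSqInt (dir 0 G) (continuous_dir hG one_ne_zero 0) r) (r : ℝ) :
    ∀ᵐ ξ ∂volume, ‖(freqLp (dir 0 G) (continuous_dir hG one_ne_zero 0) hIt r : ℝ → AngSpace) ξ‖ =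
      2 * π * |ξ| * ‖(freqLp G hG.continuous hI₀ r : ℝ → AngSpace) ξ‖ := by
  filter_upwards [freqLp_dir0_ae_eq hG hI₀ hIt r] with ξ hξ
  rw [hξ, norm_smul]
  congr 1
  simp [abs_of_pos Real.pi_pos]

/-! ### Plancherel in time

(`∫ ‖f x‖² = ‖f‖²` on `L²(ℝ; 𝓗)` is `Literature.Analysis.FunctionSpaces.integral_norm_sq_Lp`.) -/

/-- **Plancherel in time**: `∫_ξ ‖Ĝ(r, ξ)‖² dξ = ∫_t ‖G(t, r, ·)‖² dt`.
[cite: DafermosRodnianskiShlapentokhrothman2014, §5.3] -/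
theorem integral_norm_sq_freqLp (G : E4 → ℝ) (hG : Continuous G) (hI : ∀ r, TimeSqInt G hG r)
    (r : ℝ) :
    ∫ ξ, ‖(freqLp G hG hI r : ℝ → AngSpace) ξ‖ ^ 2 = ∫ t, ‖angSlice G hG t r‖ ^ 2 := by
  rw [integral_norm_sq_Lp, freqLp_def, Lp.norm_fourier_eq, ← integral_norm_sq_Lp]
  exact integral_congr_ae ((coeFn_timeLp G hG hI r).mono fun t ht ↦ by simp only [ht])

/-- **Polarised Plancherel in time**: `∫_ξ ⟪Ĝ₁, Ĝ₂⟫ dξ = ∫_t ⟪G₁(t), G₂(t)⟫ dt`.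
[cite: DafermosRodnianskiShlapentokhrothman2014, §5.3] -/
theorem integral_inner_freqLp (G₁ : E4 → ℝ) (h₁ : Continuous G₁) (hI₁ : ∀ r, TimeSqInt G₁ h₁ r)
    (G₂ : E4 → ℝ) (h₂ : Continuous G₂) (hI₂ : ∀ r, TimeSqInt G₂ h₂ r) (r : ℝ) :
    ∫ ξ, ⟪(freqLp G₁ h₁ hI₁ r : ℝ → AngSpace) ξ, (freqLp G₂ h₂ hI₂ r : ℝ → AngSpace) ξ⟫_ℂ =
      ∫ t, ⟪angSlice G₁ h₁ t r, angSlice G₂ h₂ t r⟫_ℂ := by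
  letI : MeasurableSpace AngSpace := borel _
  haveI : BorelSpace AngSpace := ⟨rfl⟩
  rw [← L2.inner_def, freqLp_def, freqLp_def, Lp.inner_fourier_eq, L2.inner_def]
  exact integral_congr_ae (((coeFn_timeLp G₁ h₁ hI₁ r).and (coeFn_timeLp G₂ h₂ hI₂ r)).mono
    fun t ht ↦ by simp only [ht.1, ht.2])

/-- **Plancherel in time, `ℝ≥0∞` form**: `∫⁻_ξ ‖Ĝ‖ₑ² = ∫⁻_t ‖G(t)‖ₑ²`.
[cite: DafermosRodnianskiShlapentokhrothman2014, §5.3] -/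
theorem lintegral_enorm_sq_freqLp (G : E4 → ℝ) (hG : Continuous G) (hI : ∀ r, TimeSqInt G hG r)
    (r : ℝ) :
    ∫⁻ ξ, ‖(freqLp G hG hI r : ℝ → AngSpace) ξ‖ₑ ^ 2 = ∫⁻ t, ‖angSlice G hG t r‖ₑ ^ 2 := by
  letI : MeasurableSpace AngSpace := borel _
  haveI : BorelSpace AngSpace := ⟨rfl⟩
  have h1 := lintegral_enorm_sq_Lp (freqLp G hG hI r)
  have h2 := lintegral_enorm_sq_Lp (timeLp G hG hI r)
  rw [freqLp_def, Lp.norm_fourier_eq] at h1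
  rw [freqLp_def, h1, ← h2]
  exact lintegral_congr_ae ((coeFn_timeLp G hG hI r).mono fun t ht ↦ by simp only [ht])

end Kerr

end Literature.Geometry.Lorentzian
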